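import Summits.Ventures.PercRepro.Night2ShadowContract
import Summits.Ventures.PercRepro.Night2LocalR1ColD
import Summits.Ventures.PercRepro.Night2LocalFourTwo

/-!
# PercRepro — the PARALLEL REDUCTION of the diagonal shadow form, and `ShadowHall M 5 3` for EVERY finite
matroid (night-2, gen 11)

`Night2ShadowContract.lean` proves the inductive step of the diagonal shadow form at `(q + 2, q)` in the regime
where a non-loop `e` lies in the closure of EVERY member of the family (`shadow_card_of_mem_closure`: contract
`e` for the members, delete `e` for the collision pairs).  The mixed regime — members with `e ∉ cl B` — is the
open piece of that induction (`DirectHullSelection`), because such a member need not be a bottom set of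
`M ＼ {e}`: its complement may lose rank when `e` is deleted.

THE OBSERVATION OF THIS FILE: if `e'` has a PARALLEL partner `e` (`e' ∈ cl {e}`, `e ≠ e'`), the mixed regime
has no bad member at all.  A member `B` with `e' ∉ cl B` cannot contain `e`, so `e` lies in `(E ∖ B) ∖ {e'}`,
which therefore still spans `e'` — the complement keeps its rank `q + 2` in `M ＼ {e'}`
(`mem_Uq_delete_of_notMem_clF`).  So the family splits cleanly: the members with `e' ∈ cl B` go to `M ／ {e'}`
(bottom sets at `(q + 1, q − 1)`, collisions `{B, B ∪ e'}` to `M ＼ {e'}` exactly as in the contraction regime),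
the members with `e' ∉ cl B` go to `M ＼ {e'}`; the two shadows land in the halves `e' ∈ S` / `e' ∉ S`, and
`((q+1)/q)·#𝒜′ + ((q+2)/(q+1))·(#𝒞 + #𝒜_d) ≥ ((q+2)/(q+1))·#𝒜` (`shadow_card_of_parallel`).

* `eRank_delete_of_mem_closure`: deleting an element spanned by the rest of the ground set keeps the rank;
* `rkN_pair_eq_two_of_notMem_closure`: two distinct nonloops that are not parallel span a set of rank `2`;
* **`shadowHall_diag_of_simple`** (every `q ≥ 1`): the diagonal shadow form at `(q + 2, q)` for every matroid
  of rank `q + 2` follows from the lower diagonal `(q + 1, q − 1)` on every matroid and the `(q + 2, q)` case on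
  the matroids of rank `q + 2` WITHOUT loops and parallel pairs (strong induction on `|E|`: delete a loop
  (`shadowHall_of_delete_loop`) or one element of a parallel pair (`shadow_card_of_parallel`));
* **`shadowHall_five_three`** / **`shadowHall_five_three_phiK`**: `ShadowHall M 5 3 (phiK 5 3)` for EVERY
  finite matroid — the `(5, 3)` instance of the lane's statement of record `ShadowC025`: the lower diagonal is
  `shadowHall_four_two` (every matroid), the simple case is `shadowHall_five_three_of_simple`
  (`Night2LocalR1ColD`), rank `≠ 5` by `Uq_eq_empty_of_eRank_lt` / `shadowHall_of_truncate`.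
  The parallel classes were the one gap left at `(5, 3)` after gen 10.
-/

open scoped Matroid

namespace PercRepro.Shadow

open Finset PerFlat ThmH

variable {α : Type} [DecidableEq α] {M : Matroid α} [M.Finite]

section Parallel

variable {q : ℕ} {e e' : α}

omit [DecidableEq α] in
/-- If `e' ∈ cl {e}` and `e ∈ B ⊆ E`, then `e' ∈ cl B`. -/
theorem mem_clF_of_mem_closure_singleton (hpar : e' ∈ M.closure {e}) {B : Finset α} (heB : e ∈ B) :
    e' ∈ clF M B := by
  rw [← Finset.mem_coe, coe_clF]
  exact M.closure_subset_closure (Set.singleton_subset_iff.2 (Finset.mem_coe.2 heB)) hpar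

/-- **No bad member in the mixed regime of a parallel element**: a bottom set `B` at `(q + 2, q)` whose closure
misses `e'`, where `e' ∈ cl {e}` for some `e ≠ e'` of the ground set, is a bottom set of `M ＼ {e'}`: `B` avoids
`e` (else `e' ∈ cl B`), so `e ∈ (E ∖ B) ∖ {e'}` spans `e'` and the complement keeps its rank `q + 2`. -/
theorem mem_Uq_delete_of_notMem_clF (he : e ∈ M.E) (hpar : e' ∈ M.closure {e}) (hne : e ≠ e')
    {B : Finset α} (hB : B ∈ Uq M (q + 2) q) (hcl : e' ∉ clF M B) :
    B ∈ Uq (M ＼ ({e'} : Set α)) (q + 2) q := by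
  have he'B : e' ∉ B := notMem_of_notMem_clF hB hcl
  have he'E : e' ∈ M.E := M.closure_subset_ground _ hpar
  rw [mem_Uq] at hB ⊢
  obtain ⟨hBg, hBq, hBc⟩ := hB
  have heB : e ∉ B := fun h => hcl (mem_clF_of_mem_closure_singleton hpar h)
  have heg : e ∈ gr M := by rw [← Finset.mem_coe, coe_gr]; exact he
  have he'g : e' ∈ gr M := by rw [← Finset.mem_coe, coe_gr]; exact he'E
  have hX : ((B : Finset α) : Set α) ⊆ M.E \ {e'} := by
    rw [← coe_gr, ← Finset.coe_erase]
    exact_mod_cast (Finset.subset_erase.2 ⟨hBg, he'B⟩)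
  refine ⟨?_, ?_, ?_⟩
  · rw [gr_delete]; exact Finset.subset_erase.2 ⟨hBg, he'B⟩
  · rw [delete_singleton_eRk_eq hX, hBq]
  · rw [gr_delete]
    have h1 : (gr M).erase e' \ B = (gr M \ B).erase e' := by
      ext x
      simp only [Finset.mem_sdiff, Finset.mem_erase]
      tauto
    rw [h1]
    have hX' : (((gr M \ B).erase e' : Finset α) : Set α) ⊆ M.E \ {e'} := by
      rw [← coe_gr, ← Finset.coe_erase]
      exact_mod_cast (Finset.erase_subset_erase e' (Finset.sdiff_subset (s := gr M) (t := B)))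
    rw [delete_singleton_eRk_eq hX']
    -- `e ∈ (E ∖ B) ∖ {e'}`, hence `e' ∈ cl ((E ∖ B) ∖ {e'})` and inserting `e'` keeps the rank
    have hemem : e ∈ (gr M \ B).erase e' := Finset.mem_erase.2 ⟨hne, Finset.mem_sdiff.2 ⟨heg, heB⟩⟩
    have hcl' : e' ∈ M.closure (((gr M \ B).erase e' : Finset α) : Set α) :=
      M.closure_subset_closure (Set.singleton_subset_iff.2 (Finset.mem_coe.2 hemem)) hpar
    have hsub : (((gr M \ B).erase e' : Finset α) : Set α) ⊆ M.E := hX'.trans Set.sdiff_subset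
    have h2 : insert e' (((gr M \ B).erase e' : Finset α) : Set α) = ((gr M \ B : Finset α) : Set α) := by
      rw [Finset.coe_erase, Set.insert_sdiff_singleton, Set.insert_eq_of_mem]
      exact Finset.mem_coe.2 (Finset.mem_sdiff.2 ⟨he'g, he'B⟩)
    rw [← eRk_insert_eq_of_mem_closure hsub hcl', h2]
    exact hBc

/-- **Counting.**  Erasing `e'` is injective on a family of finsets off its collision pairs `{B, B ∪ e'}`:
`#𝒜 ≤ #(𝒜.image (· ∖ e')) + #{B ∈ 𝒜 : e' ∉ B, B ∪ e' ∈ 𝒜}`. -/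
theorem card_le_card_image_erase_add (𝒜c : Finset (Finset α)) (e' : α) :
    𝒜c.card ≤ (𝒜c.image (fun B => B.erase e')).card +
      (𝒜c.filter (fun B => e' ∉ B ∧ insert e' B ∈ 𝒜c)).card := by
  set 𝒞 : Finset (Finset α) := 𝒜c.filter (fun B => e' ∉ B ∧ insert e' B ∈ 𝒜c) with h𝒞
  have h𝒞sub : 𝒞 ⊆ 𝒜c := Finset.filter_subset _ _
  have h1 : (𝒜c \ 𝒞).card ≤ (𝒜c.image (fun B => B.erase e')).card := by
    apply Finset.card_le_card_of_injOn (fun B => B.erase e')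
    · intro B hB
      rw [Finset.coe_sdiff] at hB
      exact Finset.mem_image_of_mem _ hB.1
    · intro B₁ hB₁ B₂ hB₂ h12
      rw [Finset.coe_sdiff] at hB₁ hB₂
      obtain ⟨hB₁A, hB₁C⟩ := hB₁
      obtain ⟨hB₂A, hB₂C⟩ := hB₂
      have h12' : B₁.erase e' = B₂.erase e' := h12
      by_contra hne'
      -- exactly one of B₁, B₂ contains e'
      by_cases h1e : e' ∈ B₁
      · by_cases h2e : e' ∈ B₂
        · apply hne'
          rw [← Finset.insert_erase h1e, ← Finset.insert_erase h2e, h12']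
        · -- B₁ = insert e' B₂, so B₂ ∈ 𝒞
          apply hB₂C
          rw [Finset.mem_coe, h𝒞, Finset.mem_filter]
          refine ⟨hB₂A, h2e, ?_⟩
          have : insert e' B₂ = B₁ := by
            rw [← Finset.insert_erase h1e, h12', Finset.erase_eq_of_notMem h2e]
          rw [this]; exact hB₁A
      · by_cases h2e : e' ∈ B₂
        · apply hB₁C
          rw [Finset.mem_coe, h𝒞, Finset.mem_filter]
          refine ⟨hB₁A, h1e, ?_⟩
          have : insert e' B₁ = B₂ := by
            rw [← Finset.insert_erase h2e, ← h12', Finset.erase_eq_of_notMem h1e]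
          rw [this]; exact hB₂A
        · apply hne'
          rw [← Finset.erase_eq_of_notMem h1e, ← Finset.erase_eq_of_notMem h2e, h12']
  have h2 : 𝒜c.card = (𝒜c \ 𝒞).card + 𝒞.card := by
    rw [Finset.card_sdiff_add_card_eq_card h𝒞sub]
  omega

/-- **The arithmetic of the parallel reduction**: `A ≤ a + d`, `((q+1)/q)·a ≤ s₁`, `((q+2)/(q+1))·d ≤ s₀` give
`((q+2)/(q+1))·A ≤ s₁ + s₀`, since `(q+2)/(q+1) ≤ (q+1)/q` for `q ≥ 1`. -/
theorem parallel_arith {q : ℕ} (hq : 1 ≤ q) {A a d s₁ s₀ : ℚ} (ha : 0 ≤ a) (hA : A ≤ a + d)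
    (h₁ : (((q : ℚ) + 1) / q) * a ≤ s₁) (h₀ : (((q : ℚ) + 2) / (q + 1)) * d ≤ s₀) :
    (((q : ℚ) + 2) / (q + 1)) * A ≤ s₁ + s₀ := by
  have hq0 : (0 : ℚ) < (q : ℚ) := by exact_mod_cast hq
  have hq1 : (0 : ℚ) < (q : ℚ) + 1 := by positivity
  have hcmp : ((q : ℚ) + 2) / (q + 1) ≤ ((q : ℚ) + 1) / q := by
    rw [div_le_div_iff₀ hq1 hq0]
    nlinarith
  have hpos : (0 : ℚ) ≤ ((q : ℚ) + 2) / (q + 1) := by positivity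
  calc (((q : ℚ) + 2) / (q + 1)) * A ≤ (((q : ℚ) + 2) / (q + 1)) * (a + d) :=
        mul_le_mul_of_nonneg_left hA hpos
    _ = (((q : ℚ) + 2) / (q + 1)) * a + (((q : ℚ) + 2) / (q + 1)) * d := by ring
    _ ≤ (((q : ℚ) + 1) / q) * a + (((q : ℚ) + 2) / (q + 1)) * d := by
        have := mul_le_mul_of_nonneg_right hcmp ha
        linarith
    _ ≤ s₁ + s₀ := add_le_add h₁ h₀

/-- **The parallel reduction at the diagonal.**  Let `e'` be a non-loop with a parallel partner `e ∈ E`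
(`e' ∈ cl {e}`, `e ≠ e'`), `r(M) = q + 2`, `q ≥ 1`.  Then the shadow condition at `(q + 2)/(q + 1)` for every
`𝒜 ⊆ Uq M (q + 2) q` follows from the shadow conditions of `M ／ {e'}` at `(q + 1, q − 1)` (constant
`(q + 1)/q`) and of `M ＼ {e'}` at `(q + 2, q)`.  Members with `e' ∈ cl B` are contracted (`B ↦ B ∖ {e'}`,
injective off the collision pairs `{B, B ∪ e'}`, which are deleted instead); members with `e' ∉ cl B` are
deleted (`mem_Uq_delete_of_notMem_clF`); the two shadows sit in the halves `e' ∈ S` / `e' ∉ S`. -/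
theorem shadow_card_of_parallel (he'i : M.Indep {e'}) (he : e ∈ M.E) (hpar : e' ∈ M.closure {e})
    (hne : e ≠ e') (hq : 1 ≤ q) (hM : M.eRank = ((q + 2 : ℕ) : ℕ∞))
    {𝒜 : Finset (Finset α)} (h𝒜 : 𝒜 ⊆ Uq M (q + 2) q)
    (IHc : ShadowHall (M ／ ({e'} : Set α)) (q + 1) (q - 1) (((q : ℚ) + 1) / q))
    (IHd : ShadowHall (M ＼ ({e'} : Set α)) (q + 2) q (((q : ℚ) + 2) / (q + 1))) :
    (((q : ℚ) + 2) / (q + 1)) * (𝒜.card : ℚ) ≤ ((shadow M (q + 2) q 𝒜).card : ℚ) := by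
  -- the two halves of `𝒜`: `e' ∈ cl B` (contracted) and `e' ∉ cl B` (deleted)
  set 𝒜c : Finset (Finset α) := 𝒜.filter (fun B => e' ∈ clF M B) with h𝒜c
  set 𝒜d : Finset (Finset α) := 𝒜.filter (fun B => e' ∉ clF M B) with h𝒜d
  have h𝒜cA : 𝒜c ⊆ 𝒜 := Finset.filter_subset _ _
  have h𝒜dA : 𝒜d ⊆ 𝒜 := Finset.filter_subset _ _
  have hsplit : 𝒜.card = 𝒜c.card + 𝒜d.card := by
    rw [h𝒜c, h𝒜d, Finset.card_filter_add_card_filter_not]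
  -- the contracted family and the collision family
  set 𝒜' : Finset (Finset α) := 𝒜c.image (fun B => B.erase e') with h𝒜'
  set 𝒞 : Finset (Finset α) := 𝒜c.filter (fun B => e' ∉ B ∧ insert e' B ∈ 𝒜c) with h𝒞
  have h𝒞sub : 𝒞 ⊆ 𝒜c := Finset.filter_subset _ _
  have hcount : 𝒜c.card ≤ 𝒜'.card + 𝒞.card := by
    have := card_le_card_image_erase_add 𝒜c e'
    rwa [← h𝒜', ← h𝒞] at this
  -- 𝒜' ⊆ Uq (M ／ {e'}) (q+1) (q-1)
  have h𝒜'U : 𝒜' ⊆ Uq (M ／ ({e'} : Set α)) (q + 1) (q - 1) := by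
    intro B' hB'
    rw [h𝒜', Finset.mem_image] at hB'
    obtain ⟨B, hB, rfl⟩ := hB'
    rw [h𝒜c, Finset.mem_filter] at hB
    exact erase_mem_Uq_contract he'i hq hM (h𝒜 hB.1) hB.2
  -- the deletion-side family 𝒟 = 𝒞 ∪ 𝒜d ⊆ Uq (M ＼ {e'}) (q+2) q
  set 𝒟 : Finset (Finset α) := 𝒞 ∪ 𝒜d with h𝒟
  have h𝒟U : 𝒟 ⊆ Uq (M ＼ ({e'} : Set α)) (q + 2) q := by
    intro B hB
    rw [h𝒟, Finset.mem_union] at hB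
    rcases hB with hB | hB
    · rw [h𝒞, Finset.mem_filter] at hB
      exact mem_Uq_delete_of_insert_mem (h𝒜 (h𝒜cA hB.1)) hB.2.1 (h𝒜 (h𝒜cA hB.2.2))
    · rw [h𝒜d, Finset.mem_filter] at hB
      exact mem_Uq_delete_of_notMem_clF he hpar hne (h𝒜 hB.1) hB.2
  have h𝒟A : 𝒟 ⊆ 𝒜 := Finset.union_subset (h𝒞sub.trans h𝒜cA) h𝒜dA
  have h𝒟card : 𝒟.card = 𝒞.card + 𝒜d.card := by
    rw [h𝒟, Finset.card_union_of_disjoint]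
    rw [Finset.disjoint_left]
    intro B hB hBd
    rw [h𝒞, Finset.mem_filter, h𝒜c, Finset.mem_filter] at hB
    rw [h𝒜d, Finset.mem_filter] at hBd
    exact hBd.2 hB.1.2
  -- the two IH shadows inside the shadow of 𝒜, in the halves e' ∈ S / e' ∉ S
  set S1 : Finset (Finset α) :=
    (shadow (M ／ ({e'} : Set α)) (q + 1) (q - 1) 𝒜').image (fun S => insert e' S) with hS1
  have hS1card : S1.card = (shadow (M ／ ({e'} : Set α)) (q + 1) (q - 1) 𝒜').card := by
    apply Finset.card_image_of_injOn
    intro S hS S' hS' hSS'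
    have h1 : e' ∉ S := (insert_mem_shadow_of_contract he'i hq (𝒜 := 𝒜c) (by rwa [← h𝒜'])).1
    have h2 : e' ∉ S' := (insert_mem_shadow_of_contract he'i hq (𝒜 := 𝒜c) (by rwa [← h𝒜'])).1
    have hSS'' : insert e' S = insert e' S' := hSS'
    calc S = (insert e' S).erase e' := (Finset.erase_insert h1).symm
      _ = (insert e' S').erase e' := by rw [hSS'']
      _ = S' := Finset.erase_insert h2
  have hS1sub : S1 ⊆ shadow M (q + 2) q 𝒜 := by
    intro S hS
    rw [hS1, Finset.mem_image] at hS
    obtain ⟨S', hS', rfl⟩ := hS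
    exact shadow_mono h𝒜cA (insert_mem_shadow_of_contract he'i hq (𝒜 := 𝒜c) (by rwa [← h𝒜'])).2
  have hS1e : ∀ S ∈ S1, e' ∈ S := by
    intro S hS
    rw [hS1, Finset.mem_image] at hS
    obtain ⟨S', -, rfl⟩ := hS
    exact Finset.mem_insert_self _ _
  set S0 : Finset (Finset α) := shadow (M ＼ ({e'} : Set α)) (q + 2) q 𝒟 with hS0
  have hS0sub : S0 ⊆ shadow M (q + 2) q 𝒜 := fun S hS => (shadow_delete_subset h𝒟A S hS).2
  have hS0e : ∀ S ∈ S0, e' ∉ S := fun S hS => (shadow_delete_subset h𝒟A S hS).1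
  have hdisj : Disjoint S1 S0 := by
    rw [Finset.disjoint_left]
    intro S h1 h0
    exact hS0e S h0 (hS1e S h1)
  have hunion : (S1 ∪ S0).card ≤ (shadow M (q + 2) q 𝒜).card :=
    Finset.card_le_card (Finset.union_subset hS1sub hS0sub)
  rw [Finset.card_union_of_disjoint hdisj, hS1card] at hunion
  -- the induction hypotheses and the arithmetic
  have hIH1 := IHc 𝒜' h𝒜'U
  have hIH0 := IHd 𝒟 h𝒟U
  have hA : (𝒜.card : ℚ) ≤ (𝒜'.card : ℚ) + (𝒟.card : ℚ) := by
    have h : 𝒜.card ≤ 𝒜'.card + 𝒟.card := by omega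
    rw [← Nat.cast_add]
    exact Nat.cast_le.2 h
  have hunion' : ((shadow (M ／ ({e'} : Set α)) (q + 1) (q - 1) 𝒜').card : ℚ) + (S0.card : ℚ)
      ≤ ((shadow M (q + 2) q 𝒜).card : ℚ) := by
    rw [← Nat.cast_add]
    exact Nat.cast_le.2 hunion
  exact (parallel_arith hq (Nat.cast_nonneg _) hA hIH1 hIH0).trans hunion'

end Parallel

section Reduction

variable {q : ℕ} {e e' f : α}

omit [DecidableEq α] [M.Finite] in
/-- Deleting an element that lies in the closure of the rest of the ground set keeps the rank. -/
theorem eRank_delete_of_mem_closure (he' : e' ∈ M.closure (M.E \ {e'})) :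
    (M ＼ ({e'} : Set α)).eRank = M.eRank := by
  rw [Matroid.eRank_def (M ＼ ({e'} : Set α)), Matroid.delete_ground,
    delete_singleton_eRk_eq (subset_refl _), ← eRk_insert_eq_of_mem_closure Set.sdiff_subset he',
    Set.insert_sdiff_singleton]
  exact Matroid.eRk_eq_eRank (Set.subset_insert _ _)

/-- Two distinct elements `e`, `f` of the ground set with `e` a non-loop and `f ∉ cl {e}` span a set of rank
`2`. -/
theorem rkN_pair_eq_two_of_notMem_closure (he : M.Indep {e}) (hf : f ∈ M.E) (hcl : f ∉ M.closure {e}) :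
    rkN M {e, f} = 2 := by
  have h1 : M.eRk (insert f ({e} : Set α)) = M.eRk {e} + 1 := Matroid.eRk_insert_eq_add_one ⟨hf, hcl⟩
  rw [he.eRk_eq_encard, Set.encard_singleton] at h1
  have h2 : M.eRk (({e, f} : Finset α) : Set α) = ((2 : ℕ) : ℕ∞) := by
    rw [Finset.coe_pair, Set.pair_comm, h1]
    rfl
  rw [eRk_eq_rkN] at h2
  exact_mod_cast h2

/-- **The diagonal shadow form reduces to simple matroids** (every `q ≥ 1`).  If the lower diagonal
`(q + 1, q − 1)` holds on every finite matroid and `(q + 2, q)` holds on every matroid of rank `q + 2` without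
loops and parallel pairs (any two distinct ground elements span rank `2`), then `(q + 2, q)` holds on every
matroid of rank `q + 2`.  Strong induction on `|E|`: a loop is deleted (`shadowHall_of_delete_loop`), one
element of a parallel pair is deleted (`shadow_card_of_parallel`); both keep the rank. -/
theorem shadowHall_diag_of_simple (hq : 1 ≤ q)
    (hlow : ∀ (N : Matroid α) [N.Finite], ShadowHall N (q + 1) (q - 1) (((q : ℚ) + 1) / q))
    (hsimple : ∀ (N : Matroid α) [N.Finite], N.eRank = ((q + 2 : ℕ) : ℕ∞) →
      (∀ e ∈ gr N, ∀ f ∈ gr N, e ≠ f → rkN N {e, f} = 2) →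
      ShadowHall N (q + 2) q (((q : ℚ) + 2) / (q + 1)))
    (M : Matroid α) [M.Finite] (hM : M.eRank = ((q + 2 : ℕ) : ℕ∞)) :
    ShadowHall M (q + 2) q (((q : ℚ) + 2) / (q + 1)) := by
  classical
  suffices h : ∀ (n : ℕ) (N : Matroid α) [N.Finite], (gr N).card ≤ n → N.eRank = ((q + 2 : ℕ) : ℕ∞) →
      ShadowHall N (q + 2) q (((q : ℚ) + 2) / (q + 1)) from h (gr M).card M le_rfl hM
  intro n
  induction n using Nat.strong_induction_on with
  | _ n ihn =>
    intro N _ hn hN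
    by_cases hL : ∃ ℓ ∈ N.E, ¬ N.Indep {ℓ}
    · -- a loop: delete it
      obtain ⟨ℓ, hℓ, hl⟩ := hL
      have hℓg : ℓ ∈ gr N := by rw [← Finset.mem_coe, coe_gr]; exact hℓ
      have hcard : (gr (N ＼ ({ℓ} : Set α))).card < n := by
        rw [gr_delete, Finset.card_erase_of_mem hℓg]
        have : 0 < (gr N).card := Finset.card_pos.2 ⟨ℓ, hℓg⟩
        omega
      have hloop : N.IsLoop ℓ := by
        by_contra h
        exact hl (Matroid.indep_singleton.2 ((Matroid.not_isLoop_iff hℓ).1 h))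
      have hrk : (N ＼ ({ℓ} : Set α)).eRank = ((q + 2 : ℕ) : ℕ∞) := by
        rw [eRank_delete_of_mem_closure (hloop.mem_closure _), hN]
      exact shadowHall_of_delete_loop hℓ hl (by positivity)
        (ihn _ hcard (N ＼ ({ℓ} : Set α)) le_rfl hrk)
    · have hloopless : ∀ e ∈ gr N, N.Indep {e} := indep_singleton_of_no_loop hL
      by_cases hP : ∀ e ∈ gr N, ∀ f ∈ gr N, e ≠ f → rkN N {e, f} = 2
      · exact hsimple N hN hP
      · -- a parallel pair `e`, `f`: delete `f`
        push Not at hP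
        obtain ⟨e, he, f, hf, hef, hr⟩ := hP
        have hfE : f ∈ N.E := by rw [← coe_gr, Finset.mem_coe]; exact hf
        have heE : e ∈ N.E := by rw [← coe_gr, Finset.mem_coe]; exact he
        have hcl : f ∈ N.closure {e} := by
          by_contra h
          exact hr (rkN_pair_eq_two_of_notMem_closure (hloopless e he) hfE h)
        have hcard : (gr (N ＼ ({f} : Set α))).card < n := by
          rw [gr_delete, Finset.card_erase_of_mem hf]
          have : 0 < (gr N).card := Finset.card_pos.2 ⟨f, hf⟩
          omega
        have hrk : (N ＼ ({f} : Set α)).eRank = ((q + 2 : ℕ) : ℕ∞) := by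
          rw [eRank_delete_of_mem_closure, hN]
          have hsub : ({e} : Set α) ⊆ N.E \ {f} :=
            Set.singleton_subset_iff.2 ⟨heE, fun h => hef (Set.mem_singleton_iff.1 h)⟩
          exact N.closure_subset_closure hsub hcl
        intro 𝒜 h𝒜
        exact shadow_card_of_parallel (hloopless f hf) heE hcl hef hq hN h𝒜 (hlow _)
          (ihn _ hcard (N ＼ ({f} : Set α)) le_rfl hrk)

end Reduction

section FiveThree

/-- `Φ(4, 2) = 4/3 = (3 + 1)/3`, the constant of the lower diagonal of `(5, 3)`. -/
theorem phiK_four_two_ratio : phiK 4 2 = (((3 : ℕ) : ℚ) + 1) / ((3 : ℕ) : ℚ) := by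
  unfold phiK
  rw [show Finset.Ioo 2 4 = {3} by decide, Finset.sum_singleton,
    show Nat.choose (4 + 2) 3 = 20 by decide, show Nat.choose (4 + 2) 4 = 15 by decide]
  norm_num

/-- `Φ(5, 3) = 5/4 = (3 + 2)/(3 + 1)`. -/
theorem phiK_five_three_ratio : phiK 5 3 = (((3 : ℕ) : ℚ) + 2) / (((3 : ℕ) : ℚ) + 1) := by
  unfold phiK
  rw [show Finset.Ioo 3 5 = {4} by decide, Finset.sum_singleton,
    show Nat.choose (5 + 3) 4 = 70 by decide, show Nat.choose (5 + 3) 5 = 56 by decide]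
  norm_num

/-- **The `(5, 3)` diagonal shadow form for every finite matroid of rank `5`**: the lower diagonal is
`shadowHall_four_two`, the simple case is `shadowHall_five_three_of_simple` (`Night2LocalR1ColD`). -/
theorem shadowHall_five_three_of_eRank (M : Matroid α) [M.Finite] (hM : M.eRank = ((5 : ℕ) : ℕ∞)) :
    ShadowHall M 5 3 ((((3 : ℕ) : ℚ) + 2) / (((3 : ℕ) : ℚ) + 1)) := by
  refine shadowHall_diag_of_simple (q := 3) (by norm_num) ?_ ?_ M hM
  · intro N _
    have h := shadowHall_four_two N
    rw [phiK_four_two_ratio] at h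
    exact h
  · intro N _ hN hs
    apply shadowHall_five_three_of_simple hs
    rw [coe_gr, Matroid.eRk_ground]
    exact hN

/-- **THE `(5, 3)` DIAGONAL SHADOW FORM OF C-025 FOR EVERY FINITE MATROID**: every sub-family `𝒜` of the
bottom sets `Uq M 5 3` has at least `(5/4)·#𝒜` rank-`4` sets above it.  Rank `< 5` has no bottom set, rank
`≥ 5` truncates to rank `5` (`shadowHall_of_truncate`). -/
theorem shadowHall_five_three (M : Matroid α) [M.Finite] :
    ShadowHall M 5 3 ((((3 : ℕ) : ℚ) + 2) / (((3 : ℕ) : ℚ) + 1)) := by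
  by_cases hlt : M.eRank < ((5 : ℕ) : ℕ∞)
  · exact shadowHall_of_Uq_empty (Uq_eq_empty_of_eRank_lt hlt)
  · have hge : ((5 : ℕ) : ℕ∞) ≤ M.eRank := not_lt.1 hlt
    apply shadowHall_of_truncate M (by norm_num : (3 : ℕ) < 5)
    apply shadowHall_five_three_of_eRank
    rw [Matroid.eRank_def, PercRepro.Matroid.truncate_ground, PercRepro.Matroid.truncate_eRk_eq_of_ge]
    rw [Matroid.eRk_ground]
    exact hge

/-- The same in the `phiK` spelling of `ShadowC025`: **`ShadowHall M 5 3 (phiK 5 3)` for every finite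
matroid** — the `(5, 3)` instance of the lane's statement of record, parallel classes included. -/
theorem shadowHall_five_three_phiK (M : Matroid α) [M.Finite] : ShadowHall M 5 3 (phiK 5 3) := by
  rw [phiK_five_three_ratio]
  exact shadowHall_five_three M

end FiveThree

end PercRepro.Shadow
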